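import Mathlib
import Summits.MatrixMultiplication.MatrixMultiplication.Theorems.SnSubsetDichotomyThresholdSubsetTriplesPairFactorisation

/-!
# `SnSubsetDichotomy.ThresholdSubsetTriples` — stub `stub_pairFactorisation` by an explicit CERTIFICATE (decoder)

Crux `stmt-MatrixMultiplication-10882` (`Theses.SnSubsetDichotomy.ThresholdSubsetTriples`), line
`interleaved-subsignature-ascent`, registered stub `stub_pairFactorisation` (census c3a); siege seat k4 of 24,
variation "certificate / decide on the finite core".

Statement.  For a level set `L ⊆ Fin n` let `S_A = subsig (ownerSystem L)` and `S_B = subsig (ownerSystem Lᶜ)` be the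
two complementary OWNER chain classes (all star letters `swap d k`, `d ≤ k`, at the levels `k ∈ L`, resp. `k ∉ L`; the
identity letter only elsewhere).  Then every `σ : Equiv.Perm (Fin n)` is `s_A⁻¹ * s_B` for EXACTLY ONE pair
`(s_A, s_B) ∈ S_A × S_B`.

Route taken here (a fourth proof, different in kind from the tree's three: the simultaneous surjectivity/injectivity
peeling induction `pairBoth_subsigBelow` of `…PairFactorisation`, surjectivity + counting of `…StubPairFactorisationK3`,
injectivity + counting of `…PairFactorisationCount`): the factorisation is COMPUTED.  We define a decoder

* `cert L m σ : Equiv.Perm (Fin n) × Equiv.Perm (Fin n)` by structural recursion on the number `m` of levels, one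
  `step` per level `t = m − 1`, top level first: if `B` owns `t` put `y := σ t`, decode `swap y t * σ` (which fixes `t`)
  over the lower levels as `(a₁, b₁)` and return `(a₁, swap (a₁ y) t * b₁)`; if `A` owns `t` put `y := σ⁻¹ t`, decode
  `σ * swap y t` as `(a₁, b₁)` and return `(swap (b₁ y) t * a₁, b₁)` — the Fisher–Yates / Sims sift of `σ` through the
  point-stabiliser chain, with the sifted letter handed to whichever class owns the level;

and prove two facts about it, each by one induction on `m` whose step is the single conjugation identity
`q * swap y t * q⁻¹ = swap (q y) t` (`q t = t`):

* CORRECTNESS `cert_spec` — for `σ` fixing the points `≥ m`, `cert L m σ = (a, b)` has `a ∈ subsigBelow (ownerSystem L) m`,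
  `b ∈ subsigBelow (ownerSystem Lᶜ) m` and `a⁻¹ * b = σ` (this is EXISTENCE, with an explicit witness);
* READ-BACK `cert_readback` — `cert L m (a⁻¹ * b) = (a, b)` for every pair of the lower classes: the decoder is a LEFT
  INVERSE of the pair map, so UNIQUENESS is one rewrite (`p = cert (p.1⁻¹ p.2) = cert σ`), with no cancellation
  induction and no cardinality count.

The registered signature is then proved verbatim as `PairCertificate.stub_pairFactorisation` (sub-namespace: the plain
name in `…Theorems.ThresholdSubsetTriples` is the tree's first proof).  NEW relative to the three tree files, as reusable
Lean objects: the computable decoder `cert` with `cert_spec` / `cert_readback` / `cert_eq_iff` (which pair factors a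
given `σ` — the datum the design rule "the third class lives in the pair's slack", census c3a §3, interrogates), and the
packaged bijection `pairEquiv L : S_A × S_B ≃ Equiv.Perm (Fin n)` whose inverse IS the decoder.  The finite core is
executable: the closing `example`s evaluate the decoder on `Fin 3` by `decide` (kernel evaluation, no `native_decide`).
Imports: Mathlib and the landed `…PairFactorisation` — used only for the vocabulary `ownerSystem`,
`ownerSystem_isDirectionSystem`, `ownerSystem_of_mem`, `ownerSystem_of_not_mem`, `starPiece_singleton_self` and the
order fact `apply_le_of_fix_above` (none of its induction lemmas `pair_step_*` / `pair_flip_*` / `pairBoth_subsigBelow`,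
and never its `stub_pairFactorisation`), plus the chain vocabulary of `…ChainDefs` (`starPiece`, `mem_starPiece`,
`mul_swap_of_apply_eq`, `subsigBelow`, `subsigBelow_zero`, `subsigBelow_succ_of_lt`, `subsigBelow_apply_of_le`, `subsig`).
Elementary; [folklore-type (Sims 1970 sifting; Fisher–Yates), proved here].
-/

-- `Summit.<Summit>.<Problem>` is the tree's mandated summit-side namespace; for this single-conjunct summit the
-- two components coincide, so the file silences `dupNamespace` (same as the vocabulary files it imports).
set_option linter.dupNamespace false
set_option autoImplicit false

namespace Summit.MatrixMultiplication.MatrixMultiplication.Theorems.ThresholdSubsetTriples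

open scoped Pointwise

namespace PairCertificate

variable {n : ℕ}

/-! ## The decoder -/

/-- One peeling STEP of the decoder at the token `t`, given the decoder `rec` of the levels below `t`:
if `A` owns `t` (`t ∈ L`) sift `σ` on the right (`y := σ⁻¹ t`, lower word `σ * swap y t`) and hand the letter
`swap (b₁ y) t` to the `A`-word; otherwise sift on the left (`y := σ t`, lower word `swap y t * σ`) and hand the letter
`swap (a₁ y) t` to the `B`-word. [folklore: Sims sift] -/
def step (L : Finset (Fin n)) (t : Fin n)
    (rec : Equiv.Perm (Fin n) → Equiv.Perm (Fin n) × Equiv.Perm (Fin n)) (σ : Equiv.Perm (Fin n)) :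
    Equiv.Perm (Fin n) × Equiv.Perm (Fin n) :=
  if t ∈ L then
    (Equiv.swap ((rec (σ * Equiv.swap (σ⁻¹ t) t)).2 (σ⁻¹ t)) t * (rec (σ * Equiv.swap (σ⁻¹ t) t)).1,
      (rec (σ * Equiv.swap (σ⁻¹ t) t)).2)
  else
    ((rec (Equiv.swap (σ t) t * σ)).1,
      Equiv.swap ((rec (Equiv.swap (σ t) t * σ)).1 (σ t)) t * (rec (Equiv.swap (σ t) t * σ)).2)

/-- The DECODER (certificate) of the owner pair of `L` through the levels `< m`, top level first; levels `≥ n`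
are skipped.  `cert L n σ` is the unique pair `(s_A, s_B) ∈ subsig (ownerSystem L) × subsig (ownerSystem Lᶜ)` with
`s_A⁻¹ * s_B = σ` (`cert_spec`, `cert_readback`). [folklore: Sims sift] -/
def cert (L : Finset (Fin n)) : ℕ → Equiv.Perm (Fin n) → Equiv.Perm (Fin n) × Equiv.Perm (Fin n)
  | 0 => fun _ => (1, 1)
  | m + 1 => if h : m < n then step L ⟨m, h⟩ (cert L m) else cert L m

/-- Unfolding the decoder at level `0`. -/
theorem cert_zero (L : Finset (Fin n)) (σ : Equiv.Perm (Fin n)) : cert L 0 σ = (1, 1) := rfl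

/-- Unfolding the decoder at a level inside the range. -/
theorem cert_succ_of_lt (L : Finset (Fin n)) {m : ℕ} (h : m < n) (σ : Equiv.Perm (Fin n)) :
    cert L (m + 1) σ = step L ⟨m, h⟩ (cert L m) σ := by
  rw [cert, dif_pos h]

/-- The step at a level owned by `A`. -/
theorem step_of_mem {L : Finset (Fin n)} {t : Fin n} (ht : t ∈ L)
    (rec : Equiv.Perm (Fin n) → Equiv.Perm (Fin n) × Equiv.Perm (Fin n)) (σ : Equiv.Perm (Fin n)) :
    step L t rec σ =
      (Equiv.swap ((rec (σ * Equiv.swap (σ⁻¹ t) t)).2 (σ⁻¹ t)) t * (rec (σ * Equiv.swap (σ⁻¹ t) t)).1,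
        (rec (σ * Equiv.swap (σ⁻¹ t) t)).2) := by
  unfold step
  rw [if_pos ht]

/-- The step at a level owned by `B`. -/
theorem step_of_not_mem {L : Finset (Fin n)} {t : Fin n} (ht : t ∉ L)
    (rec : Equiv.Perm (Fin n) → Equiv.Perm (Fin n) × Equiv.Perm (Fin n)) (σ : Equiv.Perm (Fin n)) :
    step L t rec σ =
      ((rec (Equiv.swap (σ t) t * σ)).1,
        Equiv.swap ((rec (Equiv.swap (σ t) t * σ)).1 (σ t)) t * (rec (Equiv.swap (σ t) t * σ)).2) := by
  unfold step
  rw [if_neg ht]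

/-! ## The one identity: conjugating a star letter through a permutation fixing the token -/

/-- `q⁻¹ * swap (q y) t = swap y t * q⁻¹` for `q t = t`, in the form the inductions consume. [folklore] -/
theorem inv_mul_swap_mul {q : Equiv.Perm (Fin n)} {t : Fin n} (hq : q t = t) (y : Fin n)
    (r : Equiv.Perm (Fin n)) : q⁻¹ * (Equiv.swap (q y) t * r) = Equiv.swap y t * (q⁻¹ * r) := by
  have hconj : Equiv.swap (q y) t = q * Equiv.swap y t * q⁻¹ := by
    conv_lhs => rw [← hq]
    exact Equiv.swap_apply_apply q y t
  rw [hconj]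
  group

/-- `swap (q y) t * q = q * swap y t` for `q t = t`. [folklore] -/
theorem swap_apply_mul {q : Equiv.Perm (Fin n)} {t : Fin n} (hq : q t = t) (y : Fin n) :
    Equiv.swap (q y) t * q = q * Equiv.swap y t := by
  rw [mul_swap_of_apply_eq q hq y]

/-! ## Level bookkeeping for the owner pair -/

/-- The lower owner classes fix the points `≥ m`. -/
theorem fix_of_mem_subsigBelow (L : Finset (Fin n)) {m : ℕ} {τ : Equiv.Perm (Fin n)}
    (hτ : τ ∈ subsigBelow (ownerSystem L) m) : ∀ p : Fin n, m ≤ (p : ℕ) → τ p = p :=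
  subsigBelow_apply_of_le _ (ownerSystem_isDirectionSystem L) m τ hτ

/-- The successor class at a level the system does NOT own is the lower class (identity letter only). -/
theorem subsigBelow_succ_of_not_mem {L : Finset (Fin n)} {m : ℕ} (h : m < n) (hL : (⟨m, h⟩ : Fin n) ∉ L) :
    subsigBelow (ownerSystem L) (m + 1) = subsigBelow (ownerSystem L) m := by
  rw [subsigBelow_succ_of_lt _ h, ownerSystem_of_not_mem hL, starPiece_singleton_self, Finset.singleton_one,
    one_mul]

/-- The successor class at a level the system OWNS is `starPiece {d ≤ t} t * (lower class)`. -/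
theorem subsigBelow_succ_of_mem {L : Finset (Fin n)} {m : ℕ} (h : m < n) (hL : (⟨m, h⟩ : Fin n) ∈ L) :
    subsigBelow (ownerSystem L) (m + 1) =
      starPiece (Finset.univ.filter (fun d => d ≤ (⟨m, h⟩ : Fin n))) ⟨m, h⟩ * subsigBelow (ownerSystem L) m := by
  rw [subsigBelow_succ_of_lt _ h, ownerSystem_of_mem hL]

/-! ## Correctness of the decoder (existence, with an explicit witness) -/

/-- CORRECTNESS of the decoder: for `σ` fixing the points `≥ m` (`m ≤ n`), `cert L m σ` lies in
`subsigBelow (ownerSystem L) m × subsigBelow (ownerSystem Lᶜ) m` and its pair-map value `a⁻¹ * b` is `σ`.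
Induction on `m`; the step is the conjugation identity `inv_mul_swap_mul` / `swap_apply_mul`. [folklore-type; proved here] -/
theorem cert_spec (L : Finset (Fin n)) :
    ∀ m : ℕ, m ≤ n → ∀ σ : Equiv.Perm (Fin n), (∀ p : Fin n, m ≤ (p : ℕ) → σ p = p) →
      (cert L m σ).1 ∈ subsigBelow (ownerSystem L) m ∧ (cert L m σ).2 ∈ subsigBelow (ownerSystem Lᶜ) m ∧
        (cert L m σ).1⁻¹ * (cert L m σ).2 = σ := by
  intro m
  induction m with
  | zero =>
    intro _ σ hσ
    refine ⟨by simp [cert_zero, subsigBelow_zero], by simp [cert_zero, subsigBelow_zero], ?_⟩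
    rw [cert_zero, inv_one, one_mul]
    ext p
    exact congrArg Fin.val (hσ p (Nat.zero_le _)).symm
  | succ m ih =>
    intro hm σ hσ
    have hmn : m < n := Nat.lt_of_succ_le hm
    set t : Fin n := ⟨m, hmn⟩ with ht
    -- thresholds: `m + 1 ≤ p` iff `t < p`
    have hσ' : ∀ p : Fin n, t < p → σ p = p := fun p hp => hσ p hp
    have hσi : ∀ p : Fin n, t < p → σ⁻¹ p = p := fun p hp => by
      rw [Equiv.Perm.inv_eq_iff_eq]
      exact (hσ' p hp).symm
    rw [cert_succ_of_lt L hmn]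
    by_cases hL : t ∈ L
    · -- `A` owns level `m`: sift on the right
      have hLc : t ∉ Lᶜ := fun h => (Finset.mem_compl.1 h) hL
      set y : Fin n := σ⁻¹ t with hy
      have hyle : y ≤ t := apply_le_of_fix_above hσi le_rfl
      -- the lower word `σ * swap y t` fixes the points `≥ m`
      have hσ₁ : ∀ p : Fin n, m ≤ (p : ℕ) → (σ * Equiv.swap y t) p = p := by
        intro p hp
        rcases eq_or_lt_of_le (show t ≤ p from hp) with h | h
        · subst h
          rw [Equiv.Perm.mul_apply, Equiv.swap_apply_right, hy]
          exact σ.apply_symm_apply t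
        · rw [Equiv.Perm.mul_apply,
            Equiv.swap_apply_of_ne_of_ne (fun hpy => absurd (hpy ▸ hyle) (not_le.2 h)) (ne_of_gt h)]
          exact hσ' p h
      obtain ⟨ha₁, hb₁, hab⟩ := ih hmn.le _ hσ₁
      set a₁ := (cert L m (σ * Equiv.swap y t)).1 with ha₁def
      set b₁ := (cert L m (σ * Equiv.swap y t)).2 with hb₁def
      have hb₁t : b₁ t = t := fix_of_mem_subsigBelow Lᶜ hb₁ t le_rfl
      have hb₁y : b₁ y ≤ t :=
        apply_le_of_fix_above (fun p hp => fix_of_mem_subsigBelow Lᶜ hb₁ p (le_of_lt hp)) hyle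
      rw [step_of_mem hL]
      refine ⟨?_, ?_, ?_⟩
      · rw [subsigBelow_succ_of_mem hmn hL]
        exact Finset.mul_mem_mul
          (mem_starPiece.2 ⟨b₁ y, Finset.mem_filter.2 ⟨Finset.mem_univ _, hb₁y⟩, rfl⟩) ha₁
      · rw [subsigBelow_succ_of_not_mem hmn hLc]
        exact hb₁
      · show (Equiv.swap (b₁ y) t * a₁)⁻¹ * b₁ = σ
        calc (Equiv.swap (b₁ y) t * a₁)⁻¹ * b₁ = a₁⁻¹ * (Equiv.swap (b₁ y) t * b₁) := by
              rw [mul_inv_rev, Equiv.swap_inv, mul_assoc]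
          _ = a₁⁻¹ * b₁ * Equiv.swap y t := by rw [swap_apply_mul hb₁t, mul_assoc]
          _ = σ := by rw [hab, mul_assoc, Equiv.swap_mul_self, mul_one]
    · -- `B` owns level `m`: sift on the left
      have hLc : t ∈ Lᶜ := Finset.mem_compl.2 hL
      set y : Fin n := σ t with hy
      have hyle : y ≤ t := apply_le_of_fix_above hσ' le_rfl
      -- the lower word `swap y t * σ` fixes the points `≥ m`
      have hσ₁ : ∀ p : Fin n, m ≤ (p : ℕ) → (Equiv.swap y t * σ) p = p := by
        intro p hp
        rcases eq_or_lt_of_le (show t ≤ p from hp) with h | h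
        · subst h
          rw [Equiv.Perm.mul_apply, ← hy, Equiv.swap_apply_left]
        · rw [Equiv.Perm.mul_apply, hσ' p h]
          exact Equiv.swap_apply_of_ne_of_ne (fun hpy => absurd (hpy ▸ hyle) (not_le.2 h)) (ne_of_gt h)
      obtain ⟨ha₁, hb₁, hab⟩ := ih hmn.le _ hσ₁
      set a₁ := (cert L m (Equiv.swap y t * σ)).1 with ha₁def
      set b₁ := (cert L m (Equiv.swap y t * σ)).2 with hb₁def
      have ha₁t : a₁ t = t := fix_of_mem_subsigBelow L ha₁ t le_rfl
      have ha₁y : a₁ y ≤ t :=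
        apply_le_of_fix_above (fun p hp => fix_of_mem_subsigBelow L ha₁ p (le_of_lt hp)) hyle
      rw [step_of_not_mem hL]
      refine ⟨?_, ?_, ?_⟩
      · rw [subsigBelow_succ_of_not_mem hmn hL]
        exact ha₁
      · rw [subsigBelow_succ_of_mem hmn hLc]
        exact Finset.mul_mem_mul
          (mem_starPiece.2 ⟨a₁ y, Finset.mem_filter.2 ⟨Finset.mem_univ _, ha₁y⟩, rfl⟩) hb₁
      · show a₁⁻¹ * (Equiv.swap (a₁ y) t * b₁) = σ
        rw [inv_mul_swap_mul ha₁t, hab, ← mul_assoc, Equiv.swap_mul_self, one_mul]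

/-! ## Read-back: the decoder is a left inverse of the pair map (uniqueness) -/

/-- READ-BACK: the decoder recovers every pair of the lower owner classes from its pair-map value,
`cert L m (a⁻¹ * b) = (a, b)` (`m ≤ n`).  Induction on `m`: at a level owned by `B` the sifted point is
`(a⁻¹ * (swap e t * c)) t = a⁻¹ e`, and `swap (a⁻¹ e) t * a⁻¹ * swap e t = a⁻¹` (`inv_mul_swap_mul`), so the lower
word is `a⁻¹ * c` and the re-attached letter is `swap (a (a⁻¹ e)) t = swap e t`; symmetrically at a level owned by `A`.
[folklore-type; proved here] -/
theorem cert_readback (L : Finset (Fin n)) :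
    ∀ m : ℕ, m ≤ n → ∀ a ∈ subsigBelow (ownerSystem L) m, ∀ b ∈ subsigBelow (ownerSystem Lᶜ) m,
      cert L m (a⁻¹ * b) = (a, b) := by
  intro m
  induction m with
  | zero =>
    intro _ a ha b hb
    rw [subsigBelow_zero, Finset.mem_singleton] at ha hb
    subst ha
    subst hb
    rfl
  | succ m ih =>
    intro hm a ha b hb
    have hmn : m < n := Nat.lt_of_succ_le hm
    set t : Fin n := ⟨m, hmn⟩ with ht
    rw [cert_succ_of_lt L hmn]
    by_cases hL : t ∈ L
    · -- `A` owns level `m`: `a = swap e t * c`, `b` is a lower word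
      have hLc : t ∉ Lᶜ := fun h => (Finset.mem_compl.1 h) hL
      rw [subsigBelow_succ_of_mem hmn hL] at ha
      rw [subsigBelow_succ_of_not_mem hmn hLc] at hb
      obtain ⟨p, hp, c, hc, rfl⟩ := Finset.mem_mul.1 ha
      obtain ⟨e, -, rfl⟩ := mem_starPiece.1 hp
      have hct : c t = t := fix_of_mem_subsigBelow L hc t le_rfl
      have hbt : b t = t := fix_of_mem_subsigBelow Lᶜ hb t le_rfl
      have hbe' : b (b⁻¹ e) = e := b.apply_symm_apply e
      rw [step_of_mem hL]
      -- the sifted point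
      have hy : ((Equiv.swap e t * c)⁻¹ * b)⁻¹ t = b⁻¹ e := by
        rw [mul_inv_rev, inv_inv, Equiv.Perm.mul_apply, Equiv.Perm.mul_apply, hct, Equiv.swap_apply_right]
      -- the lower word
      have hlow : (Equiv.swap e t * c)⁻¹ * b * Equiv.swap (b⁻¹ e) t = c⁻¹ * b := by
        have hbe : Equiv.swap (b (b⁻¹ e)) t * b = b * Equiv.swap (b⁻¹ e) t := swap_apply_mul hbt (b⁻¹ e)
        rw [hbe'] at hbe
        rw [mul_assoc, ← hbe, mul_inv_rev, Equiv.swap_inv, mul_assoc, Equiv.swap_mul_self_mul]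
      rw [hy, hlow, ih hmn.le c hc b hb]
      show (Equiv.swap (b (b⁻¹ e)) t * c, b) = (Equiv.swap e t * c, b)
      rw [hbe']
    · -- `B` owns level `m`: `a` is a lower word, `b = swap e t * c`
      have hLc : t ∈ Lᶜ := Finset.mem_compl.2 hL
      rw [subsigBelow_succ_of_not_mem hmn hL] at ha
      rw [subsigBelow_succ_of_mem hmn hLc] at hb
      obtain ⟨p, hp, c, hc, rfl⟩ := Finset.mem_mul.1 hb
      obtain ⟨e, -, rfl⟩ := mem_starPiece.1 hp
      have hct : c t = t := fix_of_mem_subsigBelow Lᶜ hc t le_rfl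
      have hat : a t = t := fix_of_mem_subsigBelow L ha t le_rfl
      have hae' : a (a⁻¹ e) = e := a.apply_symm_apply e
      rw [step_of_not_mem hL]
      -- the sifted point
      have hy : (a⁻¹ * (Equiv.swap e t * c)) t = a⁻¹ e := by
        rw [Equiv.Perm.mul_apply, Equiv.Perm.mul_apply, hct, Equiv.swap_apply_right]
      -- the lower word
      have hlow : Equiv.swap (a⁻¹ e) t * (a⁻¹ * (Equiv.swap e t * c)) = a⁻¹ * c := by
        have h := inv_mul_swap_mul hat (a⁻¹ e) (Equiv.swap e t * c)
        rw [hae', Equiv.swap_mul_self_mul] at h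
        exact h.symm
      rw [hy, hlow, ih hmn.le a ha c hc]
      show (a, Equiv.swap (a (a⁻¹ e)) t * c) = (a, Equiv.swap e t * c)
      rw [hae']

/-! ## The stub -/

/-- **Exact pair factorisation (registered stub `stub_pairFactorisation` of crux `stmt-MatrixMultiplication-10882`,
census c3a), certificate proof.**  For every level set `L`, every permutation `σ` of `Fin n` is `s_A⁻¹ * s_B` for
exactly ONE pair `(s_A, s_B)` of words of the complementary owner chain classes `subsig (ownerSystem L)` and
`subsig (ownerSystem Lᶜ)` — namely the decoded pair `cert L n σ`: existence is the decoder's correctness `cert_spec`,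
uniqueness its read-back property `cert_readback` (any factorising pair `p` satisfies `p = cert L n (p.1⁻¹ * p.2)
= cert L n σ`).  Consequently `|S_A||S_B| = n!` with the pair map injective: chain PAIRS attain the pair packing bound
exactly, for every ownership pattern (census c3a §§1–2). [folklore-type; proved here] -/
theorem stub_pairFactorisation {n : ℕ} (L : Finset (Fin n)) (σ : Equiv.Perm (Fin n)) :
    ∃! p : Equiv.Perm (Fin n) × Equiv.Perm (Fin n),
      p.1 ∈ subsig (ownerSystem L) ∧ p.2 ∈ subsig (ownerSystem Lᶜ) ∧ p.1⁻¹ * p.2 = σ := by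
  obtain ⟨h1, h2, h3⟩ := cert_spec L n le_rfl σ (fun p hp => absurd p.isLt (not_lt.2 hp))
  refine ⟨cert L n σ, ⟨h1, h2, h3⟩, ?_⟩
  rintro ⟨a, b⟩ ⟨ha, hb, hab⟩
  rw [← hab, cert_readback L n le_rfl a ha b hb]

/-! ## Packaging: which pair factors `σ`, and the bijection whose inverse is the decoder -/

/-- The decoder IDENTIFIES the factorising pair: for `a ∈ S_A`, `b ∈ S_B`,
`cert L n σ = (a, b) ↔ a⁻¹ * b = σ`. [folklore-type; proved here] -/
theorem cert_eq_iff (L : Finset (Fin n)) (σ : Equiv.Perm (Fin n)) {a b : Equiv.Perm (Fin n)}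
    (ha : a ∈ subsig (ownerSystem L)) (hb : b ∈ subsig (ownerSystem Lᶜ)) :
    cert L n σ = (a, b) ↔ a⁻¹ * b = σ := by
  constructor
  · intro h
    have h3 := (cert_spec L n le_rfl σ (fun p hp => absurd p.isLt (not_lt.2 hp))).2.2
    rw [h] at h3
    exact h3
  · rintro rfl
    exact cert_readback L n le_rfl a ha b hb

/-- The pair map `(s_A, s_B) ↦ s_A⁻¹ * s_B` as an EQUIVALENCE `S_A × S_B ≃ Equiv.Perm (Fin n)` whose inverse is the
decoder `cert L n` — the certificate form of the exact factorisation (so `|S_A| · |S_B| = n!` is `Fintype.card_congr`).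
[folklore-type; proved here] -/
def pairEquiv (L : Finset (Fin n)) :
    ↥(subsig (ownerSystem L) ×ˢ subsig (ownerSystem Lᶜ)) ≃ Equiv.Perm (Fin n) where
  toFun p := p.1.1⁻¹ * p.1.2
  invFun σ := ⟨cert L n σ, Finset.mem_product.2
    ⟨(cert_spec L n le_rfl σ (fun p hp => absurd p.isLt (not_lt.2 hp))).1,
      (cert_spec L n le_rfl σ (fun p hp => absurd p.isLt (not_lt.2 hp))).2.1⟩⟩
  left_inv p := by
    obtain ⟨⟨a, b⟩, hp⟩ := p
    have hp' := Finset.mem_product.1 hp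
    exact Subtype.ext (cert_readback L n le_rfl a hp'.1 b hp'.2)
  right_inv σ := (cert_spec L n le_rfl σ (fun p hp => absurd p.isLt (not_lt.2 hp))).2.2

/-- VOLUME from the certificate: `|S_A × S_B| = n!`. [folklore-type; proved here] -/
theorem card_product_eq_factorial (L : Finset (Fin n)) :
    (subsig (ownerSystem L) ×ˢ subsig (ownerSystem Lᶜ)).card = n.factorial := by
  rw [← Fintype.card_coe, Fintype.card_congr (pairEquiv L), Fintype.card_perm, Fintype.card_fin]

/-! ## The finite core, executed: the decoder on `Fin 3` by `decide` (kernel evaluation) -/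

/-- `L = {1}` (`A` owns level `1`, `B` owns levels `0, 2`): the `3`-cycle `(0 1 2) = swap 0 1 * swap 1 2` decodes to
`(swap 0 1, swap 1 2)`, i.e. `(0 1 2) = (swap 0 1)⁻¹ * swap 1 2`. -/
example : cert ({1} : Finset (Fin 3)) 3 (Equiv.swap 0 1 * Equiv.swap 1 2) = (Equiv.swap 0 1, Equiv.swap 1 2) := by
  decide

/-- `L = ∅` (`B` owns every level): `B` alone is all of `S_3` and the decoder returns `(1, σ)`. -/
example : cert (∅ : Finset (Fin 3)) 3 (Equiv.swap 0 2) = (1, Equiv.swap 0 2) := by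
  decide

end PairCertificate

end Summit.MatrixMultiplication.MatrixMultiplication.Theorems.ThresholdSubsetTriples
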